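import Literature.NumberTheory.Transcendental.DiazThm2Reductions
import Literature.NumberTheory.Transcendental.NesterenkoEliminationProp411Holds
import HarnessLib

/-!
# Diaz 1989, Théorème 2 holds (discharge of `Diaz1989_thm2`); LNM 1752 Ch. 14 Thm 2.7 (`t`)

Topic `Literature/NumberTheory/Transcendental`. Proofs only (no definitions, no named facts,
nothing asserted). The named fact `Literature.NumberTheory.Transcendental.Diaz1989_thm2`
(`DiazMain.lean`; G. Diaz, *Grands degrés de transcendance pour des familles d'exponentielles*,
J. Number Theory 31 (1989), 1–23, Théorème 2, p. 2: for `ℚ`-linearly independent `u` (`n`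
numbers) and `v` (`m` numbers) satisfying (HT2) and `mn > m + n`,
`trdeg_ℚ ℚ(e^{uᵢvⱼ}) ≥ [mn/(m+n)]`) was reduced in the tree to the single named fact
`Nesterenko.NesterenkoPhilippon2001_ch3_prop_4_11` (LNM 1752, Ch. 3, Prop. 4.11, Nesterenko's
metric Bézout inequality) by `Diaz1989_thm2_of_prop_4_11` (`DiazThm2Reductions.lean`: Diaz's
`D = 1` Schneider-type construction `DiazThm2Proofs.lean`; Philippon's criterion derived from
Ch. 3 §4, `PhilipponCriterionMain.lean`; Diaz's zero lemma and Philippon's zero estimate proved;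
Prop. 4.4 proved, Prop. 4.13 from 4.4, Cor. 4.12 from 4.11). Proposition 4.11 is now PROVED
(`Nesterenko.NesterenkoPhilippon2001_ch3_prop_4_11_holds`,
`NesterenkoEliminationProp411Holds.lean`), so Théorème 2 holds outright:

* `Diaz1989_thm2_holds` — the DISCHARGE of `Diaz1989_thm2`;
* `Diaz1989_grid_holds` — the DISCHARGE of `Diaz1989_grid` (`DiazGrid.lean`: LNM 1752, Ch. 14,
  Thm 2.7, clause `t`, under the Technical Hypothesis), through the tree's
  `Diaz1989_grid_of_thm2` (`DiazMain.lean`: (T.H.) implies (HT2),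
  `TechnicalHypothesis.measureA/measureB`).

## References

* [Diaz1989] G. Diaz, *Grands degrés de transcendance pour des familles d'exponentielles*,
  J. Number Theory 31 (1989), 1–23: Théorème 2 (p. 2), proof §II (pp. 4–16).
* [NesterenkoPhilippon2001] Yu. V. Nesterenko, P. Philippon (eds.), *Introduction to Algebraic
  Independence Theory*, LNM 1752, Springer 2001: Ch. 3 §4 Prop. 4.11 (pp. 40–41); Ch. 14
  (M. Waldschmidt) Def. 2.6 (T.H.) and Thm 2.7 ("the main result of G. Diaz in [Dia2]"), p. 248.
-/

noncomputable section

namespace Literature.NumberTheory.Transcendental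

/-- **Diaz 1989, Théorème 2, holds**: discharge of the named fact `Diaz1989_thm2`, by the tree's
one-leaf reduction `Diaz1989_thm2_of_prop_4_11` fed with the proof of LNM 1752 Ch. 3
Prop. 4.11 (`Nesterenko.NesterenkoPhilippon2001_ch3_prop_4_11_holds`).
[cite: Diaz1989, Théorème 2, p. 2; proof §II, pp. 4–16]
[cite: NesterenkoPhilippon2001, Ch. 3 Prop. 4.11 (pp. 40–41)] -/
theorem Diaz1989_thm2_holds : Diaz1989_thm2 :=
  Diaz1989_thm2_of_prop_4_11 Nesterenko.NesterenkoPhilippon2001_ch3_prop_4_11_holds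

/-- **LNM 1752, Ch. 14, Thm 2.7, clause `t`, holds** (under (T.H.) for `x₁, …, x_d` and
`y₁, …, y_ℓ`: `dℓ > ℓ + d` implies `trdeg_ℚ K ≥ [dℓ/(ℓ+d)]` for every field `K` containing the
`e^{xᵢyⱼ}`): discharge of the named fact `Diaz1989_grid`, through `Diaz1989_grid_of_thm2` and
`Diaz1989_thm2_holds`.
[cite: NesterenkoPhilippon2001, Ch. 14 Thm 2.7 (t), p. 248] -/
theorem Diaz1989_grid_holds : Diaz1989_grid :=
  Diaz1989_grid_of_thm2 Diaz1989_thm2_holds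

end Literature.NumberTheory.Transcendental

end
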